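import Mathlib
import Summits.Schanuel.Schanuel.Theses.RigidCore

/-!
# Sketch — crux-ideate round 1 (ideator 2) for `RigidCore.SparsityTwo` (stmt-Schanuel-0971)

First-lemma signatures for the two crux idea cards
`Ideas/cusp-germ-schneider-sparsity.md` and `Ideas/resonance-depth-roth-sieve.md`.
Nothing here is proved; every `def … : Prop` must elaborate.
-/

namespace Summit.Schanuel.Schanuel.Cruxes.SparsityTwo.IdeasSketch

open Filter Topology

/-- The crux, by name (sanity: the route decl is visible). -/
example : Prop := Summit.Schanuel.Schanuel.Theses.RigidCore.SparsityTwo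

/-! ## Card A — cusp-germ-schneider-sparsity -/

/-- **First lemma of card A (Runge / identity-theorem sieve for a RATIONAL polar jet).**
If `g` is analytic at `0` with `g 0 = 0` and `b K + c + g (1/K)` is an integer for infinitely many
positive integers `K`, with `b c : ℚ`, then `g` vanishes identically near `0`.
(Proof sketch: `b K + c` takes finitely many values mod 1; on an infinite subsequence the residue is
constant, `g (1/K) → 0` lies in a fixed coset of `ℤ`, hence is eventually `0`; the zeros `1/K`
accumulate at `0`; `AnalyticAt.frequently_zero_iff_eventually_zero`.) -/
def RationalJetRunge : Prop :=
  ∀ (g : ℂ → ℂ) (b c : ℚ), AnalyticAt ℂ g 0 → g 0 = 0 →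
    Set.Infinite {K : ℕ | ∃ L : ℤ, (b : ℂ) * (K : ℂ) + (c : ℂ) + g ((K : ℂ)⁻¹) = (L : ℂ)} →
    ∀ᶠ z in 𝓝 (0 : ℂ), g z = 0

/-- The counting function of integer points of the cusp germ `X ↦ b X + c + g (1/X)` up to `X`. -/
noncomputable def cuspHitCount (g : ℂ → ℂ) (b c : ℂ) (X : ℕ) : ℕ :=
  Nat.card {K : ℕ | K ≤ X ∧ ∃ L : ℤ, b * (K : ℂ) + c + g ((K : ℂ)⁻¹) = (L : ℂ)}

/-- The germ `z ↦ g z` is transcendental over `ℂ(z)` at `0`: no nonzero two-variable polynomial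
vanishes on `(z, g z)` for `z` near `0`. -/
def GermTranscendental (g : ℂ → ℂ) : Prop :=
  ¬ ∃ P : MvPolynomial (Fin 2) ℂ, P ≠ 0 ∧ ∀ᶠ z in 𝓝 (0 : ℂ), MvPolynomial.eval ![z, g z] P = 0

/-- **Main statement of card A (Schneider–Waldschmidt at the cusp, anchored by accumulation).**
A germ `h(X) = b X + c + g(1/X)` analytic at infinity up to the linear term, with `g` transcendental
over `ℂ(z)` (ANY complex slope `b`, any `c`), takes integer values at positive integers only on a set
of ZERO LOWER LOGARITHMIC DENSITY: `liminf_X #{K ≤ X : h K ∈ ℤ} / log X = 0`.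
(The trivial bound for irrational real `b` is `O(log X)`; BNZ gives `(log X)^κ`.) -/
def CuspGermZeroLowerLogDensity : Prop :=
  ∀ (g : ℂ → ℂ) (b c : ℂ), AnalyticAt ℂ g 0 → g 0 = 0 → GermTranscendental g →
    Filter.liminf (fun X : ℕ => (cuspHitCount g b c X : ℝ) / Real.log (X : ℝ)) Filter.atTop = 0

/-! ## Card B — resonance-depth-roth-sieve -/

/-- **First lemma of card B (Liouville depth sieve, provable in Mathlib now).**
For a real algebraic irrational `β` and any `m ≥ deg β`, only finitely many positive integers `q`
admit an integer `p` with `|β q - p| ≤ C / q ^ m`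
(`exists_pos_real_of_irrational_root`: `|β - p/q| ≥ A / q ^ deg`). -/
def LiouvilleDepthFinite : Prop :=
  ∀ (β : ℝ), IsAlgebraic ℚ β → Irrational β → ∀ (C : ℝ) (m : ℕ),
    (minpoly ℚ β).natDegree ≤ m →
      Set.Finite {q : ℕ | 0 < q ∧ ∃ p : ℤ, |β * (q : ℝ) - (p : ℝ)| ≤ C / (q : ℝ) ^ m}

/-- **Roth depth sieve (named fact shape; Roth's theorem is not in Mathlib).**
Same conclusion for every `m ≥ 2`, any degree: `|β q - p| ≤ C/q^m`, `m ≥ 2`, gives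
`|β - p/q| ≤ C/q^3`, excluded for large `q` by Roth. -/
def RothDepthFinite : Prop :=
  ∀ (β : ℝ), IsAlgebraic ℚ β → Irrational β → ∀ (C : ℝ) (m : ℕ), 2 ≤ m →
    Set.Finite {q : ℕ | 0 < q ∧ ∃ p : ℤ, |β * (q : ℝ) - (p : ℝ)| ≤ C / (q : ℝ) ^ m}

/-- **Depth sieve at a linear torsion cusp (the crux-facing form).**
If the cusp germ is `h(X) = β X + c + g(1/X)` with `β` real algebraic irrational, `c : ℚ`, `g`
analytic at `0` REAL on reals and vanishing at `0` to order `≥ m + 1` with `m ≥ deg β`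
(resonance depth `≥ deg β`), then `h` takes integer values at only finitely many positive integers.
(`h K = L` forces `|β K + c - L| = |g(1/K)| ≤ C/K^{m+1}`; clear the denominator of `c`; Liouville.) -/
def LinearCuspDepthFinite : Prop :=
  ∀ (β : ℝ) (c : ℚ) (g : ℝ → ℝ) (m : ℕ), IsAlgebraic ℚ β → Irrational β →
    (minpoly ℚ β).natDegree ≤ m → AnalyticAt ℝ g 0 →
    (∃ C : ℝ, ∀ᶠ x in 𝓝 (0 : ℝ), |g x| ≤ C * |x| ^ (m + 1)) →
      Set.Finite {K : ℕ | ∃ L : ℤ, β * (K : ℝ) + (c : ℝ) + g ((K : ℝ)⁻¹) = (L : ℝ)}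

end Summit.Schanuel.Schanuel.Cruxes.SparsityTwo.IdeasSketch
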